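import Literature.IUT.HodgeTheaters.PuncturedEllipticCoveringsCor12OfGeomOriginEx48Rational
import Literature.IUT.HodgeTheaters.PuncturedEllipticCoveringsCor12InertiaCentralOfCuspGalois
import HarnessLib

/-!
# [IUTchI] Cor. 1.2 at the genuine `K`-level data — closer «cor12_v14»: (L4) DISCHARGED from (∗) with cusp rationality taken
# from the cusp action `C : CuspGalois` — LAW = the six `Δ_ε` label sentences, NO extra binder (proof-only knit, R48)

Mochizuki, *Inter-universal Teichmüller theory I*, kurims manuscript (May 2020), §1 pp. 37–39, Corollary 1.2 and its proof
p. 39 l. 19–46; p. 37 l. 20–24 ((∗)) and p. 38 l. 22–24 [cite: Mochizuki2012, IUTchI Cor 1.2 p.39] (D-0012 claim key; series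
status DISPUTED — nothing of the series is asserted here).

PROOF-ONLY knit (cell abc-iut, seat abc-iut-L5-t1 gen 11; L5 ROWS #7 R48 «COR12-KNIT»; HUB census `plan/L5/SUBDAG-IUTchI-Cor12.md`
§W).  ONE theorem, all by name: this seat's `InitialThetaData.pe_characteristicNatureOfCoverings_of_geomOrigin_ex48_rational`
(p501412: abc-iut-w6-d032's closer p496734 with (L4) discharged by `GeomOrigin.inertia_central_of_rational`, p500241) with its two
origin-shaped binders `hrat hrat′` («every cusp of `X̲` is `k`-rational») SUPPLIED by abc-iut-w4-d051's theorem
`PuncturedEllipticData.CuspGalois.aug_decomp_surjective` (`PuncturedEllipticCoveringsCor12InertiaCentralOfCuspGalois.lean`,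
p501910): every decomposition group `D_x` is a `Π_X`-conjugate of `D_{2ε}` under the cusp action `C : CuspGalois` that the closer
already carries as DATA, and `D_{2ε} ↠ G_k` is the interface field `aug_decomp_twoε`.
DISPLAYED TELESCOPE of `InitialThetaData.pe_characteristicNatureOfCoverings_of_geomOrigin_ex48_cuspGalois` = that of p496734
(«cor12_v12») MINUS `hL4 hL4′`: DATA `C C′ A O O′` + model/member/realisation data · FACT-INSTANCE `hEx` (F-0193), `h33`
(F-0294), `hA hA′` (F-0206) · CLASS SHAPE `h𝒟` · GAP `h0 h0′` (G-L5d4g6-1) · **LAW = EXACTLY the six printed `Δ_ε` LABEL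
sentences `hL2a hL2c hL3` ×2** (route DERIVE, abc-iut-L5-d4 R45; `hL3` ×2 reduce to the cusp-span sentence (CS) over
`GeomOriginIota`, `PuncturedEllipticCoveringsCor12IotaNegOfOrigin.lean`).

HONEST FRAMING: a by-name composition; origin records, model/member/realisation data are assumption-shaped DATA asserted for no
instance; typed ≠ discharged for F-0193/F-0294/F-0206 (FACT policy); nothing here bears on [IUTchIII] Cor. 3.12 or asserts that abc
is proved or refuted.  No `def`, no instance, no new `Prop` fact.
-/

noncomputable section

open CategoryTheory Topology

namespace Literature.IUT.HodgeTheaters.InitialThetaData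

open scoped Pointwise
open Literature.AlgebraicGeometry.Frobenioids (IsSlimGroup)
open Literature.AnabelianGeometry.AbsoluteAnabelian
open Literature.AnabelianGeometry.AbsoluteAnabelian.FundamentalExtension (CuspidalAlgorithm)
open Literature.AnabelianGeometry.AbsoluteAnabelian.AbsTopI (ConstructionDataClass)
open Literature.AnabelianGeometry.AbsoluteAnabelian.AbsTopII (EllipticModel)

universe u u'

variable {F : Type u} {K : Type} {Fbar : Type} [Field F] [NumberField F] [Field K] [NumberField K]
  [Algebra F K] [Field Fbar] [Algebra F Fbar] [Algebra K Fbar]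
  {E : WeierstrassCurve F} [E.IsElliptic] {l : ℕ} {Pb : BadPlacePredicates K}
  (D : InitialThetaData F K Fbar E l Pb)
  {F' : Type u'} {K' : Type} [Field F'] [NumberField F'] [Field K'] [NumberField K'] [Algebra F' K']
  {Fbar' : Type} [Field Fbar'] [Algebra F' Fbar'] [Algebra K' Fbar']
  {E' : WeierstrassCurve F'} [E'.IsElliptic] {l' : ℕ} {Pb' : BadPlacePredicates K'}
  (D' : InitialThetaData F' K' Fbar' E' l' Pb')

/-- **[IUTchI] Cor. 1.2 between the `K`-level data of two initial Θ-data — closer «cor12_v14»**: p501412's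
`…_of_geomOrigin_ex48_rational` with `hrat := C.aug_decomp_surjective`, `hrat′ := C′.aug_decomp_surjective` (abc-iut-w4-d051,
p501910): (L4) is a theorem of the field (∗), the origin records `O O′` and the cusp actions `C C′`, with NO extra binder.  LAW
binders = the six printed `Δ_ε` label sentences (L2a)(L2c)(L3) at the two data; FACT rows F-0193, F-0294, F-0206 by name; GAP
G-L5d4g6-1; the rest DATA. ([IUTchI] Cor 1.2 p.39) [claim: Mochizuki2012, status: disputed] -/
theorem pe_characteristicNatureOfCoverings_of_geomOrigin_ex48_cuspGalois
    (O : D.geom.pe.GeomOrigin) (O' : D'.geom.pe.GeomOrigin)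
    (C : D.geom.pe.CuspGalois) (C' : D'.geom.pe.CuspGalois)
    -- a class of [AbsTopI] Example 4.8 (i) with its named fact F-0193, a Cor 3.3/3.4 model over it, F-0294 by name
    {𝒟 : ConstructionDataClass.{0}} {p : ℕ} [Fact p.Prime] (h𝒟 : 𝒟.IsEx48ClassGen p) (hEx : 𝒟.Ex_4_8_i p)
    (M : EllipticModel 𝒟) (h33 : M.Cor_3_3_i)
    -- members X, X′ over number fields, realised by Π_{X̲→}, Π′_{X̲→} with k-cores Π_C, Π′_C
    {bX bX' : 𝒟.Base} [NumberField (𝒟.fld bX)] [NumberField (𝒟.fld bX')]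
    {X : (𝒟.datum bX).Obj} {X' : (𝒟.datum bX').Obj}
    (hmemX : 𝒟.Mem bX X) (hadmX : M.IsEllipticallyAdmissible bX X) (hΔX : IsSlimGroup ((𝒟.datum bX).ext X).geom)
    (hneX : ((𝒟.datum bX).ext X).geom ≠ ⊥) (htfgX : ((𝒟.datum bX).ext X).GeomTFG)
    (hmemX' : 𝒟.Mem bX' X') (hadmX' : M.IsEllipticallyAdmissible bX' X') (hΔX' : IsSlimGroup ((𝒟.datum bX').ext X').geom)
    (hneX' : ((𝒟.datum bX').ext X').geom ≠ ⊥) (htfgX' : ((𝒟.datum bX').ext X').GeomTFG)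
    (hS : (𝒟.datum bX').primes = (𝒟.datum bX).primes)
    (ePi : ((𝒟.datum bX).ext X).arith ≃ₜ* D.geom.pe.piXarrow) (eC : (M.coreExt bX X).arith ≃ₜ* D.geom.pe.PiC)
    (hcomp : ∀ x, eC ((M.toCore bX X).arith x) = (ePi x : D.geom.pe.PiC))
    (ePi' : ((𝒟.datum bX').ext X').arith ≃ₜ* D'.geom.pe.piXarrow) (eC' : (M.coreExt bX' X').arith ≃ₜ* D'.geom.pe.PiC)
    (hcomp' : ∀ x, eC' ((M.toCore bX' X').arith x) = (ePi' x : D'.geom.pe.PiC))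
    -- members Y, Y′ over number fields, realised by Π_{C̲→}, Π′_{C̲→} with k-cores Π_C, Π′_C
    {bY bY' : 𝒟.Base} [NumberField (𝒟.fld bY)] [NumberField (𝒟.fld bY')]
    {Y : (𝒟.datum bY).Obj} {Y' : (𝒟.datum bY').Obj}
    (hmemY : 𝒟.Mem bY Y) (hadmY : M.IsEllipticallyAdmissible bY Y) (hΔY : IsSlimGroup ((𝒟.datum bY).ext Y).geom)
    (hneY : ((𝒟.datum bY).ext Y).geom ≠ ⊥) (htfgY : ((𝒟.datum bY).ext Y).GeomTFG)
    (hmemY' : 𝒟.Mem bY' Y') (hadmY' : M.IsEllipticallyAdmissible bY' Y') (hΔY' : IsSlimGroup ((𝒟.datum bY').ext Y').geom)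
    (hneY' : ((𝒟.datum bY').ext Y').geom ≠ ⊥) (htfgY' : ((𝒟.datum bY').ext Y').GeomTFG)
    (hSY : (𝒟.datum bY').primes = (𝒟.datum bY).primes)
    (fPi : ((𝒟.datum bY).ext Y).arith ≃ₜ* D.geom.pe.piCarrow) (fC : (M.coreExt bY Y).arith ≃ₜ* D.geom.pe.PiC)
    (hcompY : ∀ x, fC ((M.toCore bY Y).arith x) = (fPi x : D.geom.pe.PiC))
    (fPi' : ((𝒟.datum bY').ext Y').arith ≃ₜ* D'.geom.pe.piCarrow) (fC' : (M.coreExt bY' Y').arith ≃ₜ* D'.geom.pe.PiC)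
    (hcompY' : ∀ x, fC' ((M.toCore bY' Y').arith x) = (fPi' x : D'.geom.pe.PiC))
    -- the six printed Δ_ε-level LABEL sentences (L2a)(L2c)(L3) at the two data
    (hL2a : D.geom.pe.deltaEpsKer.relIndex (D.geom.pe.inertia D.geom.pe.ε1 ⊔ D.geom.pe.deltaEpsKer) = D.geom.pe.l)
    (hL2c : D.geom.pe.inertia D.geom.pe.ε1 ⊓ (D.geom.pe.inertia D.geom.pe.ε2 ⊔ D.geom.pe.deltaEpsKer) ≤
      D.geom.pe.deltaEpsKer)
    (hL3 : ∀ c ∈ D.geom.pe.DeltaCbar, c ∉ D.geom.pe.DeltaXbar → ∀ v ∈ D.geom.pe.DeltaXbar,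
      c * v * c⁻¹ * v ∈ D.geom.pe.inertia D.geom.pe.ε1 ⊔ D.geom.pe.inertia D.geom.pe.ε2 ⊔ D.geom.pe.deltaEpsKer)
    (hL2a' : D'.geom.pe.deltaEpsKer.relIndex (D'.geom.pe.inertia D'.geom.pe.ε1 ⊔ D'.geom.pe.deltaEpsKer) =
      D'.geom.pe.l)
    (hL2c' : D'.geom.pe.inertia D'.geom.pe.ε1 ⊓ (D'.geom.pe.inertia D'.geom.pe.ε2 ⊔ D'.geom.pe.deltaEpsKer) ≤
      D'.geom.pe.deltaEpsKer)
    (hL3' : ∀ c ∈ D'.geom.pe.DeltaCbar, c ∉ D'.geom.pe.DeltaXbar → ∀ v ∈ D'.geom.pe.DeltaXbar,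
      c * v * c⁻¹ * v ∈
        D'.geom.pe.inertia D'.geom.pe.ε1 ⊔ D'.geom.pe.inertia D'.geom.pe.ε2 ⊔ D'.geom.pe.deltaEpsKer)
    -- ramification of ε⁰ (GAP G-L5d4g6-1) and [AbsTopI] Lem 4.5 (v) (F-0206)
    (h0 : ¬ D.geom.pe.inertia D.geom.pe.ε0 ≤ D.geom.pe.piXarrow)
    (h0' : ¬ D'.geom.pe.inertia D'.geom.pe.ε0 ≤ D'.geom.pe.piXarrow)
    (A : CuspidalAlgorithm.{0}) (hA : A.RecoversCusps D.geom.pe.extXbar C.cuspidalDataXbar)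
    (hA' : A.RecoversCusps D'.geom.pe.extXbar C'.cuspidalDataXbar) :
    D.geom.pe.CharacteristicNatureOfCoverings D'.geom.pe :=
  D.pe_characteristicNatureOfCoverings_of_geomOrigin_ex48_rational D' O O' C C' h𝒟 hEx M h33 hmemX hadmX hΔX hneX htfgX hmemX'
    hadmX' hΔX' hneX' htfgX' hS ePi eC hcomp ePi' eC' hcomp' hmemY hadmY hΔY hneY htfgY hmemY' hadmY' hΔY' hneY' htfgY' hSY fPi
    fC hcompY fPi' fC' hcompY' C.aug_decomp_surjective C'.aug_decomp_surjective hL2a hL2c hL3 hL2a' hL2c' hL3' h0 h0' A hA hA'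

end Literature.IUT.HodgeTheaters.InitialThetaData
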